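import Literature.MathematicalPhysics.QuantumFieldTheory.CharacterExpansionTwistLocality
import Literature.MathematicalPhysics.QuantumFieldTheory.TomboulisMKFlowAtROne
import Literature.Probability.LatticeModels.ClusterExpansionKPBound
import Literature.Probability.LatticeModels.AnchoredClusterExpansion
import HarnessLib

/-!
# The strong-coupling vortex free-energy bound for Tomboulis's character action:
# `StrongCouplingRegime d` holds for every `d` (hypothesis (H_sc) of «(5.16) ⟹ confinement» discharged)

Topic `Literature/MathematicalPhysics/QuantumFieldTheory`; vocabulary of `TomboulisVortexDecimation.lean` /
`TomboulisConfinementClaim.lean` (namespace `Tomboulis2007`: `torusZ`, `torusZtw`, `vortexSheet`, `vortexRatio`,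
`coeffNorm`, `CoeffAdmissible`, `StrongCouplingTwistBound`, `StrongCouplingRegime`, the chain
`electricFluxAreaLawAlong_of_chain*`), of `CharacterActionPolymers.lean` / `CharacterActionPolymerExpansion.lean` /
`CharacterExpansionTwistLocality.lean` (polymer representation, Kotecký–Preiss smallness, twist locality) and of
`Literature.Probability.LatticeModels.{ClusterExpansion, ClusterExpansionKPBound, AnchoredClusterExpansion}`
(the PROVED Kotecký–Preiss theorem `koteckyPreiss_truncatedWeight_bound_holds`, the anchored difference formula
`polymerLogZ_sub_eq_sum_filter`). THEOREMS ONLY (no definition, no new fact); net effect: the predicate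
`StrongCouplingRegime d` of `TomboulisConfinementClaim.lean` — there "a `Prop` in `d` alone, nothing asserted" —
is PROVED for every `d`.

The source statement.  E. T. Tomboulis, arXiv:0707.2179 [Tomboulis2007Confinement] §6.2: once the coefficients are
"within the region of convergence of the strong coupling expansion", "`ln Z⁻ - ln Z = Σ_X a(X)(∏ z⁻(Y_i)^{n_i} - ∏ z(Y_i)^{n_i})`
where the sum is only over all such topologically nontrivial linked clusters, the contribution of all other clusters
canceling in the difference. The minimal cluster of this type consists of a single polymer which is a 2-dimensional
plane … thus of size `A = L₁L₂`" (eqs. (6.10)–(6.11)), whence the confining behaviour (6.2)/(6.12) of the vortex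
free energy [Münster, Nucl. Phys. B180 (1981) 23]; K. R. Ito, E. Seiler, arXiv:0803.3019 [ItoSeiler2008Further]
Thm 2.2 (1): for `β < β₁` the vortex free energy obeys the area decay law — "a standard result of the convergent
high-temperature expansion (see for instance [Seiler, LNP 159])".  The tree's `StrongCouplingRegime d` is the
symmetric-torus rendering: `∃ ε > 0`, every admissible `{c_j}` (any cut-off `J`) with `‖g‖ = Σ_j d_j² c_j ≤ ε` has
`σ > 0`, `C` with `1 - Z⁻_Λ/Z_Λ ≤ C L^{d-2} e^{-σL²}` for all `L ≥ 2` and all planes.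

The proof (Kotecký–Preiss cluster expansion of the link-connected polymer gas; Osterwalder–Seiler 1978 §3):
* `polymerLogZ_sub_polymerLogZ_vortexSheet_eq` — T07 (6.10): by twist locality (`CharacterExpansionTwistLocality`)
  the two Kotecký–Preiss logarithms differ only by the truncated functionals of clusters containing a polymer with
  `≥ L²` plaquettes;
* `sum_norm_truncatedWeight_large_le` — estimate (4) of [KP86] with `a = d = |·|`, anchored at the `#plaquettes`
  one-plaquette polymers: those clusters weigh `≤ #plaquettes · e^{-L²}` (for both activity functions);
* `one_sub_vortexRatio_le_card_mul_exp` — `1 - Z⁻/Z ≤ ln Z - ln Z⁻ ≤ 2 · #plaquettes · e^{-L²}` inside the explicit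
  region `(8(d-1)+1)² e² ‖g‖ ≤ 1/2` (positivity of `Z`, `Z⁻` and `ln Z⁻ = Re log Ξ` from
  `CharacterActionPolymerExpansion`);
* `strongCouplingTwistBound_of_kp` — constants: `#plaquettes ≤ d² L^d` and `L² e^{-L²/2} ≤ 1` give
  `StrongCouplingTwistBound d J c (1/2) (2d²)`;
* **`strongCouplingRegime_holds (d) : StrongCouplingRegime d`** with `ε(d) = 1/(2(8(d-1)+1)² e²)`, `σ = 1/2`,
  `C = 2d²`;
* `electricFluxAreaLawAlong_of_chain_on_posDomain_sc`, `electricFluxAreaLawAlong_of_chain_four_sc` — the chain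
  theorems of `TomboulisChainTelescoping` / `TomboulisMKFlowAtROne` with (H_sc) discharged: at `r = 1`, `d = 4`, for
  positive data the standing premises are EXACTLY Appendix C's claim (H_C) and the disputed inequality (5.16) (H_516).

HONEST FRAMING: a finite-volume theorem about the strong-coupling regime of the character expansion (small `‖g‖`),
uniform in the volume and the cut-off; it says nothing about (5.15)/(5.16), about large `β`, or about confinement —
it removes one uncontested hypothesis from the typed chain, leaving precisely the disputed content as premises.
-/

noncomputable section

open MeasureTheory Finset
open scoped BigOperators
open Literature.MathematicalPhysics.QuantumLattice
open Literature.Probability.LatticeModels (IsRConnected GeomInc Touches)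

namespace Literature.MathematicalPhysics.QuantumFieldTheory

namespace Tomboulis2007

variable {d L : ℕ}

/-! ## Part D — the vortex free-energy bound and the discharge of `StrongCouplingRegime` -/

section VortexFreeEnergy

variable [NeZero L]

open Literature.Probability.LatticeModels

/-- Covering bound (plumbing): if every member of `𝒞` lies in one of the families `S p`, `p ∈ P`, then a
non-negative sum over `𝒞` is at most the sum over `p` of the sums over `S p`. [folklore] -/
private theorem sum_le_sum_sum_of_cover {ι κ : Type*} [DecidableEq ι] (𝒞 : Finset ι) (P : Finset κ)
    (S : κ → Finset ι) {g : ι → ℝ} (hg : ∀ C, 0 ≤ g C) (hcover : ∀ C ∈ 𝒞, ∃ p ∈ P, C ∈ S p) :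
    ∑ C ∈ 𝒞, g C ≤ ∑ p ∈ P, ∑ C ∈ S p, g C := by
  classical
  calc ∑ C ∈ 𝒞, g C ≤ ∑ C ∈ 𝒞, ∑ p ∈ P with C ∈ S p, g C := by
        refine Finset.sum_le_sum fun C hC => ?_
        obtain ⟨p, hp, hR⟩ := hcover C hC
        rw [Finset.sum_const, nsmul_eq_mul]
        have h1 : (1 : ℝ) ≤ (P.filter fun p => C ∈ S p).card := by
          exact_mod_cast Finset.card_pos.2 ⟨p, Finset.mem_filter.2 ⟨hp, hR⟩⟩
        nlinarith [hg C]
    _ = ∑ p ∈ P, ∑ C ∈ 𝒞 with C ∈ S p, g C := by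
        rw [Finset.sum_comm' (t' := P) (s' := fun p => 𝒞.filter fun C => C ∈ S p)]
        intro C p
        simp only [Finset.mem_filter]
        tauto
    _ ≤ ∑ p ∈ P, ∑ C ∈ S p, g C := Finset.sum_le_sum fun p _ =>
        Finset.sum_le_sum_of_subset_of_nonneg (fun C hC => (Finset.mem_filter.1 hC).2) fun C _ _ => hg C

/-- `‖g‖ < 1` inside the Kotecký–Preiss region (plumbing). [cite: Tomboulis2007Confinement, §2 eq. (2.11)] -/
theorem coeffNorm_lt_one_of_kp {J : ℕ} {c : ℕ → ℝ} (hc : CoeffAdmissible c)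
    (hε : (((8 * (d - 1) : ℕ) : ℝ) + 1) ^ 2 * (Real.exp 2 * coeffNorm J c) ≤ 1 / 2) : coeffNorm J c < 1 := by
  have hD : (1 : ℝ) ≤ (((8 * (d - 1) : ℕ) : ℝ) + 1) ^ 2 := by
    have : (0 : ℝ) ≤ ((8 * (d - 1) : ℕ) : ℝ) := Nat.cast_nonneg _
    nlinarith
  have he : (1 : ℝ) ≤ Real.exp 2 := Real.one_le_exp (by norm_num)
  have h0 := coeffNorm_nonneg (J := J) hc
  have h2 : coeffNorm J c ≤ Real.exp 2 * coeffNorm J c := le_mul_of_one_le_left h0 he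
  have h3 : Real.exp 2 * coeffNorm J c ≤ (((8 * (d - 1) : ℕ) : ℝ) + 1) ^ 2 * (Real.exp 2 * coeffNorm J c) :=
    le_mul_of_one_le_left (by positivity) hD
  linarith

/-- **The twisted-minus-untwisted cluster expansion** (arXiv:0707.2179 eq. (6.10): "`ln Z⁻ - ln Z = Σ_X a(X)(∏ z⁻ - ∏ z)`,
where the sum is only over all such topologically nontrivial linked clusters, the contribution of all other
clusters canceling in the difference"): the Kotecký–Preiss logarithms of `Z⁻_V` and `Z` differ by the truncated
functionals of the clusters containing a polymer with at least `L²` plaquettes.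
[cite: Tomboulis2007Confinement, §6.2 eq. (6.10)] -/
theorem polymerLogZ_sub_polymerLogZ_vortexSheet_eq (J : ℕ) (c : ℕ → ℝ) {i j : Fin d} (hij : i < j) :
    polymerLogZ (GeomInc linkRel) (polymerActivity J c ∅) (torusPolymers d L) -
        polymerLogZ (GeomInc linkRel) (polymerActivity J c (vortexSheet L i j hij)) (torusPolymers d L) =
      ∑ C ∈ (torusPolymers d L).powerset with
          (C ∩ (torusPolymers d L).filter fun X => L ^ 2 ≤ X.card).Nonempty,
        (truncatedWeight (GeomInc linkRel) (polymerActivity J c ∅) C -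
          truncatedWeight (GeomInc linkRel) (polymerActivity J c (vortexSheet L i j hij)) C) := by
  refine polymerLogZ_sub_eq_sum_filter _ _ fun γ hγ hγT => ?_
  have hlt : γ.card < L ^ 2 := by
    by_contra h
    exact hγT (Finset.mem_filter.2 ⟨hγ, not_lt.1 h⟩)
  exact (polymerActivity_vortexSheet_eq_of_card_lt J c hij hlt).symm

/-- The tail estimate for an arbitrary family of clusters each containing a polymer with `≥ L²` plaquettes
(plumbing form of the next theorem). [cite: KoteckyPreiss1986, Theorem p. 492, estimate (4)] -/
theorem sum_norm_truncatedWeight_le_of_large {J : ℕ} {c : ℕ → ℝ} (hc : CoeffAdmissible c)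
    (hε : (((8 * (d - 1) : ℕ) : ℝ) + 1) ^ 2 * (Real.exp 2 * coeffNorm J c) ≤ 1 / 2)
    (V : Finset (Plaquette d L)) (𝒞 : Finset (Finset (Finset (Plaquette d L))))
    (hlarge : ∀ C ∈ 𝒞, ∃ X ∈ C, X ∈ torusPolymers d L ∧ L ^ 2 ≤ X.card) :
    ∑ C ∈ 𝒞, ‖truncatedWeight (GeomInc linkRel) (polymerActivity J c V) C‖ ≤
      (Fintype.card (Plaquette d L) : ℝ) * Real.exp (-((L : ℝ) ^ 2)) := by
  classical
  haveI : Std.Refl (GeomInc (linkRel (d := d) (L := L))) := ⟨geomInc_refl _⟩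
  haveI : Std.Symm (GeomInc (linkRel (d := d) (L := L))) := ⟨fun _ _ h => geomInc_symm _ linkRel_symm h⟩
  have hfact := koteckyPreiss_truncatedWeight_bound_holds (GeomInc linkRel) (polymerActivity J c V)
    (fun X : Finset (Plaquette d L) => (X.card : ℝ)) (fun X : Finset (Plaquette d L) => (X.card : ℝ))
  have h1 := kp_hypothesis_polymerActivity_tsum hc hε V
  -- every cluster of `𝒞` has `d`-size `≥ L²` and touches a one-plaquette polymer
  have hsize : ∀ C ∈ 𝒞, ((L : ℝ) ^ 2) ≤ ∑ γ' ∈ C, ((γ'.card : ℕ) : ℝ) := by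
    intro C hC
    obtain ⟨X, hXC, -, hXL⟩ := hlarge C hC
    have h := Finset.single_le_sum (f := fun γ' : Finset (Plaquette d L) => ((γ'.card : ℕ) : ℝ))
      (fun γ' _ => Nat.cast_nonneg _) hXC
    exact le_trans (by exact_mod_cast hXL) h
  have hstep := fun p : Plaquette d L => sum_norm_truncatedWeight_le_exp_neg_of_touches hfact
    (fun _ => Nat.cast_nonneg _) (fun _ => Nat.cast_nonneg _) h1 𝒞 {p} (r := (L : ℝ) ^ 2)
    (fun C hC _ => hsize C hC)
  have hsum := Finset.sum_le_sum fun p (_ : p ∈ (Finset.univ : Finset (Plaquette d L))) => hstep p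
  refine ((sum_le_sum_sum_of_cover 𝒞 Finset.univ _ (fun C => norm_nonneg _) ?_).trans hsum).trans (le_of_eq ?_)
  · intro C hC
    obtain ⟨X, hXC, hXP, -⟩ := hlarge C hC
    obtain ⟨p, hp⟩ := nonempty_of_mem_torusPolymers hXP
    exact ⟨p, Finset.mem_univ _, Finset.mem_filter.2
      ⟨hC, X, hXC, Or.inr ⟨p, hp, p, Finset.mem_singleton_self p, Or.inl rfl⟩⟩⟩
  · simp only [Finset.card_singleton, Nat.cast_one, mul_one, Finset.sum_const, Finset.card_univ, nsmul_eq_mul]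

/-- **The tail of the expansion**: inside the Kotecký–Preiss region, for every twist set, the truncated functionals
of the clusters containing a polymer with `≥ L²` plaquettes have total size at most `#plaquettes · e^{-L²}`
(anchor each such cluster at a plaquette of its large polymer and use estimate (4) of [KP86] with `d = |·|`;
arXiv:0707.2179 (6.11)–(6.12): the minimal such cluster has activity `c_{1/2}^{A}`, `A = L₁L₂`, and there are
`∏_{κ≠1,2} L_κ` of them). [cite: Tomboulis2007Confinement, §6.2 eqs. (6.10)–(6.12)] -/
theorem sum_norm_truncatedWeight_large_le {J : ℕ} {c : ℕ → ℝ} (hc : CoeffAdmissible c)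
    (hε : (((8 * (d - 1) : ℕ) : ℝ) + 1) ^ 2 * (Real.exp 2 * coeffNorm J c) ≤ 1 / 2)
    (V : Finset (Plaquette d L)) :
    ∑ C ∈ (torusPolymers d L).powerset with
        (C ∩ (torusPolymers d L).filter fun X => L ^ 2 ≤ X.card).Nonempty,
        ‖truncatedWeight (GeomInc linkRel) (polymerActivity J c V) C‖ ≤
      (Fintype.card (Plaquette d L) : ℝ) * Real.exp (-((L : ℝ) ^ 2)) := by
  refine sum_norm_truncatedWeight_le_of_large hc hε V _ fun C hC => ?_
  obtain ⟨X, hX⟩ := (Finset.mem_filter.1 hC).2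
  rw [Finset.mem_inter, Finset.mem_filter] at hX
  exact ⟨X, hX.1, hX.2.1, hX.2.2⟩

/-- **The vortex free-energy bound, raw form**: inside the explicit Kotecký–Preiss region
`(8(d-1)+1)² e² ‖g‖ ≤ 1/2`, on every symmetric torus and for every plane,
`1 - Z⁻_Λ/Z_Λ ≤ ln Z_Λ - ln Z⁻_Λ ≤ 2 · #plaquettes · e^{-L²}` (arXiv:0707.2179 §6.2 (6.10)–(6.12): only the
clusters wrapping the twisted plane survive in `ln Z⁻ - ln Z`, and they are exponentially small in the area
`A = L²`; IS08 Thm 2.2 (1): "a standard result of the convergent high-temperature expansion").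
[cite: Tomboulis2007Confinement, §6.2 eqs. (6.10)–(6.12)] [cite: ItoSeiler2008Further, §2 Thm 2.2 (1)] -/
theorem one_sub_vortexRatio_le_card_mul_exp {J : ℕ} {c : ℕ → ℝ} (hc : CoeffAdmissible c)
    (hε : (((8 * (d - 1) : ℕ) : ℝ) + 1) ^ 2 * (Real.exp 2 * coeffNorm J c) ≤ 1 / 2) {i j : Fin d} (hij : i < j) :
    1 - vortexRatio d L J c (vortexSheet L i j hij) ≤
      2 * (Fintype.card (Plaquette d L) : ℝ) * Real.exp (-((L : ℝ) ^ 2)) := by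
  have h1 := coeffNorm_lt_one_of_kp (d := d) hc hε
  have hZ := torusZ_pos_of_coeffNorm_lt_one (d := d) (L := L) hc h1
  have hZtw := torusZtw_pos_of_coeffNorm_lt_one (d := d) (L := L) hc h1 (vortexSheet L i j hij)
  have hratio : 0 < vortexRatio d L J c (vortexSheet L i j hij) := div_pos hZtw hZ
  set ℓ₀ := polymerLogZ (GeomInc linkRel) (polymerActivity J c ∅) (torusPolymers d L) with hℓ₀
  set ℓ₁ := polymerLogZ (GeomInc linkRel) (polymerActivity J c (vortexSheet L i j hij)) (torusPolymers d L) with hℓ₁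
  have hlogZ : Real.log (torusZ d L J c) = ℓ₀.re := by
    rw [← torusZtw_empty d L J c, hℓ₀]
    exact log_torusZtw_eq_re_polymerLogZ hc hε ∅
  have hlogZtw : Real.log (torusZtw d L J c (vortexSheet L i j hij)) = ℓ₁.re :=
    log_torusZtw_eq_re_polymerLogZ hc hε _
  calc 1 - vortexRatio d L J c (vortexSheet L i j hij)
      ≤ -Real.log (vortexRatio d L J c (vortexSheet L i j hij)) := by
        linarith [Real.log_le_sub_one_of_pos hratio]
    _ = Real.log (torusZ d L J c) - Real.log (torusZtw d L J c (vortexSheet L i j hij)) := by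
        unfold vortexRatio
        rw [Real.log_div hZtw.ne' hZ.ne']
        ring
    _ = (ℓ₀ - ℓ₁).re := by rw [Complex.sub_re, hlogZ, hlogZtw]
    _ ≤ ‖ℓ₀ - ℓ₁‖ := Complex.re_le_norm _
    _ = ‖∑ C ∈ (torusPolymers d L).powerset with
            (C ∩ (torusPolymers d L).filter fun X => L ^ 2 ≤ X.card).Nonempty,
          (truncatedWeight (GeomInc linkRel) (polymerActivity J c ∅) C -
            truncatedWeight (GeomInc linkRel) (polymerActivity J c (vortexSheet L i j hij)) C)‖ := by
        rw [hℓ₀, hℓ₁, polymerLogZ_sub_polymerLogZ_vortexSheet_eq J c hij]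
    _ ≤ ∑ C ∈ (torusPolymers d L).powerset with
            (C ∩ (torusPolymers d L).filter fun X => L ^ 2 ≤ X.card).Nonempty,
          (‖truncatedWeight (GeomInc linkRel) (polymerActivity J c ∅) C‖ +
            ‖truncatedWeight (GeomInc linkRel) (polymerActivity J c (vortexSheet L i j hij)) C‖) :=
        (norm_sum_le _ _).trans (Finset.sum_le_sum fun C _ => norm_sub_le _ _)
    _ ≤ (Fintype.card (Plaquette d L) : ℝ) * Real.exp (-((L : ℝ) ^ 2)) +
          (Fintype.card (Plaquette d L) : ℝ) * Real.exp (-((L : ℝ) ^ 2)) := by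
        rw [Finset.sum_add_distrib]
        exact add_le_add (sum_norm_truncatedWeight_large_le hc hε ∅)
          (sum_norm_truncatedWeight_large_le hc hε (vortexSheet L i j hij))
    _ = 2 * (Fintype.card (Plaquette d L) : ℝ) * Real.exp (-((L : ℝ) ^ 2)) := by ring

/-! ### Constants: the number of plaquettes and the Gaussian factor -/

/-- `#plaquettes ≤ d² L^d` on the torus `(ℤ/Lℤ)^d`. [folklore] -/
private theorem card_plaquette_le : (Fintype.card (Plaquette d L) : ℝ) ≤ (d : ℝ) ^ 2 * (L : ℝ) ^ d := by
  classical
  have h : Fintype.card (Plaquette d L) ≤ d ^ 2 * L ^ d := by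
    rw [Fintype.card_prod]
    have hS : Fintype.card (Site d L) = L ^ d := by
      rw [Fintype.card_pi, Finset.prod_const, ZMod.card, Finset.card_univ, Fintype.card_fin]
    have hP : Fintype.card {p : Fin d × Fin d // p.1 < p.2} ≤ d ^ 2 := by
      refine (Fintype.card_subtype_le _).trans ?_
      rw [Fintype.card_prod, Fintype.card_fin, sq]
    rw [hS, mul_comm]
    exact Nat.mul_le_mul_right _ hP
  exact_mod_cast h

omit [NeZero L] in
/-- `x ≤ e^{x/2}` for `x ≥ 0` (`(1 + x/4)² ≥ x`). [folklore] -/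
private theorem le_exp_half {x : ℝ} (hx : 0 ≤ x) : x ≤ Real.exp (x / 2) := by
  have h := Real.add_one_le_exp (x / 4)
  have h2 : Real.exp (x / 2) = Real.exp (x / 4) ^ 2 := by
    rw [← Real.exp_nat_mul]; ring_nf
  rw [h2]
  nlinarith [sq_nonneg (1 - x / 4), Real.exp_pos (x / 4)]

omit [NeZero L] in
/-- `L^d e^{-L²} ≤ L^{d-2} e^{-L²/2}` for `d ≥ 2`. [folklore] -/
private theorem pow_mul_exp_neg_sq_le (hd : 2 ≤ d) (L : ℕ) :
    (L : ℝ) ^ d * Real.exp (-((L : ℝ) ^ 2)) ≤ (L : ℝ) ^ (d - 2) * Real.exp (-(1 / 2 * (L : ℝ) ^ 2)) := by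
  have hL2 : (0 : ℝ) ≤ (L : ℝ) ^ 2 := by positivity
  have hx := le_exp_half hL2
  have hsplit : (L : ℝ) ^ d = (L : ℝ) ^ (d - 2) * (L : ℝ) ^ 2 := by
    rw [← pow_add, Nat.sub_add_cancel hd]
  have hexp : Real.exp (-((L : ℝ) ^ 2)) = Real.exp (-(1 / 2 * (L : ℝ) ^ 2)) * Real.exp (-((L : ℝ) ^ 2 / 2)) := by
    rw [← Real.exp_add]; ring_nf
  rw [hsplit, hexp]
  have hkey : (L : ℝ) ^ 2 * Real.exp (-((L : ℝ) ^ 2 / 2)) ≤ 1 := by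
    rw [Real.exp_neg]
    have hpos := Real.exp_pos ((L : ℝ) ^ 2 / 2)
    rw [mul_inv_le_iff₀ hpos, one_mul]
    exact hx
  have hnn : 0 ≤ (L : ℝ) ^ (d - 2) * Real.exp (-(1 / 2 * (L : ℝ) ^ 2)) := by positivity
  calc (L : ℝ) ^ (d - 2) * (L : ℝ) ^ 2 * (Real.exp (-(1 / 2 * (L : ℝ) ^ 2)) * Real.exp (-((L : ℝ) ^ 2 / 2)))
      = ((L : ℝ) ^ (d - 2) * Real.exp (-(1 / 2 * (L : ℝ) ^ 2))) * ((L : ℝ) ^ 2 * Real.exp (-((L : ℝ) ^ 2 / 2))) := by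
        ring
    _ ≤ ((L : ℝ) ^ (d - 2) * Real.exp (-(1 / 2 * (L : ℝ) ^ 2))) * 1 := mul_le_mul_of_nonneg_left hkey hnn
    _ = (L : ℝ) ^ (d - 2) * Real.exp (-(1 / 2 * (L : ℝ) ^ 2)) := mul_one _

/-- **The strong-coupling twist bound with explicit constants**: for admissible coefficients with
`(8(d-1)+1)² e² ‖g‖ ≤ 1/2`, `StrongCouplingTwistBound d J c (1/2) (2 d²)` holds, i.e.
`1 - Z⁻_Λ/Z_Λ ≤ 2 d² L^{d-2} e^{-L²/2}` on every symmetric torus of side `L ≥ 2` and every plane.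
[cite: Tomboulis2007Confinement, §6.2 eqs. (6.10)–(6.14)] [cite: ItoSeiler2008Further, §2 Thm 2.2 (1)] -/
theorem strongCouplingTwistBound_of_kp (d : ℕ) {J : ℕ} {c : ℕ → ℝ} (hc : CoeffAdmissible c)
    (hε : (((8 * (d - 1) : ℕ) : ℝ) + 1) ^ 2 * (Real.exp 2 * coeffNorm J c) ≤ 1 / 2) :
    StrongCouplingTwistBound d J c (1 / 2) (2 * (d : ℝ) ^ 2) := by
  intro L _ i j hij _
  have hd : 2 ≤ d := by
    have hi := i.isLt
    have hj := j.isLt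
    have : (i : ℕ) < j := hij
    omega
  calc 1 - vortexRatio d L J c (vortexSheet L i j hij)
      ≤ 2 * (Fintype.card (Plaquette d L) : ℝ) * Real.exp (-((L : ℝ) ^ 2)) :=
        one_sub_vortexRatio_le_card_mul_exp hc hε hij
    _ ≤ 2 * ((d : ℝ) ^ 2 * (L : ℝ) ^ d) * Real.exp (-((L : ℝ) ^ 2)) :=
        mul_le_mul_of_nonneg_right (mul_le_mul_of_nonneg_left card_plaquette_le (by norm_num))
          (Real.exp_nonneg _)
    _ = 2 * (d : ℝ) ^ 2 * ((L : ℝ) ^ d * Real.exp (-((L : ℝ) ^ 2))) := by ring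
    _ ≤ 2 * (d : ℝ) ^ 2 * ((L : ℝ) ^ (d - 2) * Real.exp (-(1 / 2 * (L : ℝ) ^ 2))) :=
        mul_le_mul_of_nonneg_left (pow_mul_exp_neg_sq_le hd L) (by positivity)
    _ = 2 * (d : ℝ) ^ 2 * (L : ℝ) ^ (d - 2) * Real.exp (-(1 / 2 * (L : ℝ) ^ 2)) := by ring

end VortexFreeEnergy

/-- **`StrongCouplingRegime d` holds for every dimension `d`** — the discharge of hypothesis (H_sc) of
`ConfinementFromIneq516` / `ConfinementFromMKT`: with `ε(d) = 1 / (2 (8(d-1)+1)² e²)`, every admissible character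
action with `‖g‖ = Σ_j d_j² c_j ≤ ε(d)` (any spin cut-off `J`) obeys the strong-coupling twist bound
`1 - Z⁻_Λ/Z_Λ ≤ 2 d² L^{d-2} e^{-L²/2}` on every symmetric torus `(ℤ/Lℤ)^d`, `L ≥ 2`, and every plane
(arXiv:0707.2179 §6.2: "within the region of convergence of the strong coupling expansion" the vortex free energy
shows "the confining behavior (6.2)"; IS08 Thm 2.2 (1): "a standard result of the convergent high-temperature
expansion"; proved here by the Kotecký–Preiss cluster expansion of the link-connected polymer gas, Münster 1981 /
Osterwalder–Seiler 1978 §3). [cite: Tomboulis2007Confinement, §6.2 eqs. (6.5)–(6.14)] [cite: ItoSeiler2008Further, §2 Thm 2.2 (1)] -/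
theorem strongCouplingRegime_holds (d : ℕ) : StrongCouplingRegime d := by
  have hpos : (0 : ℝ) < (((8 * (d - 1) : ℕ) : ℝ) + 1) ^ 2 * Real.exp 2 := by positivity
  refine ⟨(1 / 2) / ((((8 * (d - 1) : ℕ) : ℝ) + 1) ^ 2 * Real.exp 2), div_pos (by norm_num) hpos, ?_⟩
  intro J c hc hε
  have hε' : (((8 * (d - 1) : ℕ) : ℝ) + 1) ^ 2 * (Real.exp 2 * coeffNorm J c) ≤ 1 / 2 := by
    rw [le_div_iff₀ hpos] at hε
    calc (((8 * (d - 1) : ℕ) : ℝ) + 1) ^ 2 * (Real.exp 2 * coeffNorm J c)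
        = coeffNorm J c * ((((8 * (d - 1) : ℕ) : ℝ) + 1) ^ 2 * Real.exp 2) := by ring
      _ ≤ 1 / 2 := hε
  exact ⟨1 / 2, by norm_num, 2 * (d : ℝ) ^ 2, strongCouplingTwistBound_of_kp d hc hε'⟩

/-! ## Consequences for the chain «(5.16) ⟹ confinement»: the strong-coupling premise is discharged -/

section Chain

/-- **The chain on the positivity domain without (H_sc)**: for every dimension `d`, exponent parameter `r ≥ 0`,
admissible data whose upper-bound column stays non-negative, flowing to strong coupling in norm, Appendix C's
claim and THE DISPUTED INEQUALITY (5.16) at every level give the electric-flux area law along the decimation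
subsequence — `StrongCouplingRegime d` is now a theorem (`strongCouplingRegime_holds`).
[cite: Tomboulis2007Confinement, §5 Props. V.1–V.2 and §6.2] [cite: ItoSeiler2008Further, §2 Thm 2.2 (1)] -/
theorem electricFluxAreaLawAlong_of_chain_on_posDomain_sc (d J : ℕ) (c : ℕ → ℝ) (b : ℕ) [NeZero b] (r : ℝ)
    (hc : CoeffAdmissible c) (hr : 0 ≤ r)
    (hf : ∀ m (U : SU2), 0 ≤ plaqFn (cutoffIter d J b m) (upperCoeffIter d J c b r m) U)
    (hFlow : UpperFlowInNorm d J c b r)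
    (hC : ∀ (n L : ℕ) [NeZero L] (i j : Fin d) (hij : i < j), 1 ≤ n → 2 ≤ L → AppendixCClaim d L b J n r hij c)
    (h516 : ∀ (n L : ℕ) [NeZero L] (i j : Fin d) (hij : i < j), 1 ≤ n → 2 ≤ L → Ineq516AtLevel d L b J n r hij c) :
    ∀ (i j : Fin d) (hij : i < j), ∃ n : ℕ, ElectricFluxAreaLawAlong d b n J c hij :=
  electricFluxAreaLawAlong_of_chain_on_posDomain d J c b r hc hr hf hFlow (strongCouplingRegime_holds d) hC h516

/-- **The `r = 1`, `d = 4` chain for a positive datum, premises EXACTLY {(H_C), (H_516)}**: for Wilson-type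
positive character data `f_c > 0` (e.g. Wilson's action at any `β`), scale `b ≥ 2`: IF Appendix C's claim holds at
every level, coarse side and plane, and IF the disputed inequality (5.16) holds at every level on every coarse ray,
THEN every plane has a level with the electric-flux area law — (H_pos), (H_flow) [Ito's theorem], (H_sc) [this
file], (H_V1), (H_V2) being theorems of the tree.  What is assumed is precisely what Ito–Seiler dispute
(arXiv:0711.4930 §3: (5.15) "not proven"; arXiv:0803.3019 §3.2 Problems 1–3).
[cite: Tomboulis2007Confinement, Abstract and §6.2] [cite: ItoSeiler2007Tomboulis, §3] [cite: ItoSeiler2008Further, §3.2] -/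
theorem electricFluxAreaLawAlong_of_chain_four_sc (J : ℕ) (c : ℕ → ℝ) (b : ℕ) [NeZero b] (hb : 2 ≤ b)
    (hc : CoeffAdmissible c) (hf : ∀ U : SU2, 0 < plaqFn J c U)
    (hC : ∀ (n L : ℕ) [NeZero L] (i j : Fin 4) (hij : i < j), 1 ≤ n → 2 ≤ L → AppendixCClaim 4 L b J n 1 hij c)
    (h516 : ∀ (n L : ℕ) [NeZero L] (i j : Fin 4) (hij : i < j), 1 ≤ n → 2 ≤ L →
      Ineq516AtLevel 4 L b J n 1 hij c) :
    ∀ (i j : Fin 4) (hij : i < j), ∃ n : ℕ, ElectricFluxAreaLawAlong 4 b n J c hij :=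
  electricFluxAreaLawAlong_of_chain_four J c b hb hc hf (strongCouplingRegime_holds 4) hC h516

/-- **The `r = 1` chain in every dimension `d` with (H_sc) discharged**: for admissible data with non-negative plaquette
function, scale `b ≥ 1`, IF the upper-bound column flows to strong coupling in norm at `r = 1` (Tomboulis's (3.43); a
theorem at `d = 4` for positive data, `electricFluxAreaLawAlong_of_chain_four_sc`), Appendix C's claim holds and the
disputed inequality (5.16) holds at every level, THEN every plane has a level with the electric-flux area law — the
`r = 1` form `electricFluxAreaLawAlong_of_chain_one` of `SU2CharacterConvolution.lean` without its hypothesis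
`StrongCouplingRegime d`. [cite: Tomboulis2007Confinement, Abstract, §2.2 eq. (2.28), §6.2] [cite: ItoSeiler2008Further, §2 Thm 2.2 (1)] -/
theorem electricFluxAreaLawAlong_of_chain_one_sc (d J : ℕ) (c : ℕ → ℝ) (b : ℕ) [NeZero b]
    (hc : CoeffAdmissible c) (hf : ∀ U : SU2, 0 ≤ plaqFn J c U) (hFlow : UpperFlowInNorm d J c b 1)
    (hC : ∀ (n L : ℕ) [NeZero L] (i j : Fin d) (hij : i < j), 1 ≤ n → 2 ≤ L → AppendixCClaim d L b J n 1 hij c)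
    (h516 : ∀ (n L : ℕ) [NeZero L] (i j : Fin d) (hij : i < j), 1 ≤ n → 2 ≤ L → Ineq516AtLevel d L b J n 1 hij c) :
    ∀ (i j : Fin d) (hij : i < j), ∃ n : ℕ, ElectricFluxAreaLawAlong d b n J c hij :=
  electricFluxAreaLawAlong_of_chain_one d J c b hc hf hFlow (strongCouplingRegime_holds d) hC h516

end Chain

end Tomboulis2007

end Literature.MathematicalPhysics.QuantumFieldTheory

end
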